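import Mathlib
import HarnessLib
import Literature.AlgebraicGeometry.Ramification.InertiaNormalSylow
import Literature.AlgebraicGeometry.Ramification.NormalSylowExtensions
import Literature.AlgebraicGeometry.Resolution.ResolutionOfSingularities
import Literature.AlgebraicGeometry.Resolution.Blowups
import Literature.AlgebraicGeometry.Resolution.BlowupsExistence
import Literature.AlgebraicGeometry.Resolution.BlowupsEquivariant
import Literature.AlgebraicGeometry.Resolution.BlowupsIntegral
import Literature.AlgebraicGeometry.Resolution.BlowupsProperProofs
import Literature.AlgebraicGeometry.Resolution.BlowupRegularPoints
import Literature.AlgebraicGeometry.Resolution.QuasiExcellentSchemes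
import Summits.ResolutionOfSingularities.ResolutionOfSingularities.Theorems.WildQuotientsWildQuotientResolutionStubInertiaLe
import Summits.ResolutionOfSingularities.ResolutionOfSingularities.Theorems.WildQuotientsWildQuotientResolutionStubStableAffineCoverBlowup

/-!
# The POINT MOVE of Phase 0 in any dimension: blow up a finite stable set of closed points — regular model, lifted action, stable affine cover, NPC only over NPC (crux `WildQuotients.WildQuotientResolution`)

Crux stmt-ResolutionOfSingularities-15640 (`WildQuotientResolution`), line `Sketch` (card
`p-closure-sylow-separation`), registered stub `stub_phaseZeroHighDim`. Companion of
`CurveStep.curveMove` (`Theorems/…CurveStep.lean`): the other move of a Phase-0 game in dimension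
`≥ 3`, the equivariant blow-up of a finite `G`-stable set `Z` of closed points (used to regularise
and separate the curves of non-p-closed inertia before the curve moves, and on isolated NPC
points). All structural clauses of the stub hold in ANY dimension — proper, birational, integral,
REGULAR (`IsBlowup.isRegularLocalRing_stalk_of_finite` over `Z`, isomorphism off `Z`),
equivariant, `G`-stable affine cover (`StableAffineCoverBlowup.stub_stableAffineCoverBlowup`) —
and non-p-closed inertia upstairs lies over non-p-closed inertia downstairs (`I_x ≤ I_{π x}`).
What the point move does to the inertia OVER `Z` is the content of `FlagStepPoint` /
`FlagKernels` (p-closed iff the action on the hyperplane `W̄` of the cotangent space is); in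
dimension `≤ 2` it is always p-closed (`PhaseZeroDimTwo.phaseZero_dimLE_two`, whose proof this
file follows clause by clause).

[OURS · crux stmt-ResolutionOfSingularities-15640 · helper toward `stub_phaseZeroHighDim`; counted
0; AI-level work, weaker than expert review.]
-/

-- single-problem summit: the doubled namespace component `ResolutionOfSingularities` is forced
set_option linter.dupNamespace false

namespace Summit.ResolutionOfSingularities.ResolutionOfSingularities.Theorems.WildQuotientResolution.PointMove

open CategoryTheory AlgebraicGeometry TopologicalSpace IsLocalRing
open Literature.AlgebraicGeometry.Resolution Literature.AlgebraicGeometry.Ramification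

/-- **The point move of Phase 0 (any dimension).** For the crux data — `k` a field,
`X₁ → Spec k` separated of finite type, `q : X′ → X₁` finite with `X′` integral and regular, `G`
finite acting on `X′` over `q` — and a finite closed `G`-stable (`(ρ g)⁻¹ Z = Z`) set `Z` of
closed points with `𝓘_Z ≠ 0` (i.e. `Z ≠ X′`), the blow-up of the reduced ideal `𝓘_Z` with its lifted
action is a `G`-equivariant proper birational model `π : X♯ → X′` with `X♯` integral and regular, a
`G`-stable affine open neighbourhood of every point, and `NPC(X♯) ⊆ π⁻¹ NPC(X′)`: a point of `X♯`
with non-p-closed inertia lies over a point of `X′` with non-p-closed inertia.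
[folklore assembly, after `PhaseZeroDimTwo.phaseZero_dimLE_two`] -/
theorem pointMove (p : ℕ) (hp : p.Prime) (k : Type) [Field k]
    (X' X₁ : Scheme.{0}) (f : X₁ ⟶ Spec (.of k)) (q : X' ⟶ X₁) (G : Type) [Group G] [Finite G]
    (ρ : G →* Aut X') [IsSeparated f] [LocallyOfFiniteType f] [QuasiCompact f] [IsIntegral X']
    (hreg : Scheme.IsRegular X') [IsFinite q] (hρ : ∀ g : G, (ρ g).hom ≫ q = q)
    {Z : Set X'} (hZc : IsClosed Z) (hZf : Z.Finite) (hZpt : ∀ z ∈ Z, IsClosed ({z} : Set X'))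
    (hZstab : ∀ g : G, (ρ g).hom.base ⁻¹' Z = Z)
    (hJne : Scheme.IdealSheafData.vanishingIdeal (⟨Z, hZc⟩ : Closeds X') ≠ ⊥) :
    ∃ (Xs : Scheme.{0}) (π : Xs ⟶ X') (ρs : G →* Aut Xs), IsProper π ∧ IsBirational π ∧
      IsIntegral Xs ∧ Scheme.IsRegular Xs ∧ (∀ g : G, (ρs g).hom ≫ π = π ≫ (ρ g).hom) ∧
      IsBlowup π (Scheme.IdealSheafData.vanishingIdeal ⟨Z, hZc⟩) ∧
      (∀ x : Xs, ¬ HasNormalSylow p (inertiaSubgroup ρs x) →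
        ¬ HasNormalSylow p (inertiaSubgroup ρ (π.base x))) ∧
      ∀ x : Xs, ∃ U : Xs.Opens, IsAffineOpen U ∧ x ∈ U ∧ ∀ g : G, (ρs g).hom ⁻¹ᵁ U = U := by
  haveI : Fact p.Prime := ⟨hp⟩
  -- `X′` is Noetherian and separated (finite over the separated finite-type `X₁/k`)
  haveI : IsLocallyNoetherian X' := LocallyOfFiniteType.isLocallyNoetherian (q ≫ f)
  haveI : X'.IsSeparated := Scheme.isSeparated_of_isSeparated_over (q ≫ f)
  -- the blow-up and the lifted action
  obtain ⟨Xs, π, hπ⟩ := exists_isBlowup X' (Scheme.IdealSheafData.vanishingIdeal ⟨Z, hZc⟩)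
  have hJG : ∀ g : G, (Scheme.IdealSheafData.vanishingIdeal (⟨Z, hZc⟩ : Closeds X')).comap
      (ρ g).hom = Scheme.IdealSheafData.vanishingIdeal ⟨Z, hZc⟩ :=
    vanishingIdeal_comap_eq_of_action ρ ⟨Z, hZc⟩ hZstab
  let ρs : G →* Aut Xs := hπ.liftAction ρ hJG
  have hequiv : ∀ g : G, (ρs g).hom ≫ π = π ≫ (ρ g).hom := hπ.liftAction_hom_comp ρ hJG
  haveI hXs : IsIntegral Xs := hπ.isIntegral hJne
  haveI hπp : IsProper π := hπ.isProper
  have hbir : IsBirational π := hπ.isBirational' hJne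
  -- regularity of `X♯`
  have hRo : IsOpen (Scheme.regularLocus X') := by
    have : Scheme.regularLocus X' = Set.univ := Set.eq_univ_of_forall fun x => hreg x
    rw [this]
    exact isOpen_univ
  have hXsreg : Scheme.IsRegular Xs := by
    intro x
    by_cases hx : π.base x ∈ Z
    · exact IsBlowup.isRegularLocalRing_stalk_of_finite hRo hZc hZf hZpt (fun z _ => hreg z) hπ hx
    · set W₀ : X'.Opens := ⟨((Scheme.IdealSheafData.vanishingIdeal (⟨Z, hZc⟩ : Closeds X')).support :
          Set X')ᶜ, (Scheme.IdealSheafData.vanishingIdeal (⟨Z, hZc⟩ : Closeds X')).support.isClosed.isOpen_compl⟩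
        with hW₀
      haveI : IsIso (π ∣_ W₀) := hπ.isIso_compl
      have hxW : x ∈ π ⁻¹ᵁ W₀ := by
        change π.base x ∈ ((Scheme.IdealSheafData.vanishingIdeal (⟨Z, hZc⟩ : Closeds X')).support :
          Set X')ᶜ
        rw [Scheme.IdealSheafData.coe_support_vanishingIdeal]
        exact hx
      have hregW : Scheme.IsRegular (↑(π ⁻¹ᵁ W₀) : Scheme.{0}) :=
        Scheme.IsRegular.of_isOpenImmersion (π ∣_ W₀ ≫ W₀.ι) hreg
      haveI := hregW ⟨x, hxW⟩
      exact IsRegularLocalRing.of_ringEquiv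
        (asIso ((π ⁻¹ᵁ W₀).ι.stalkMap ⟨x, hxW⟩)).commRingCatIsoToRingEquiv.symm
  refine ⟨Xs, π, ρs, hπp, hbir, hXs, hXsreg, hequiv, hπ, fun x hx h => hx ?_, fun x => ?_⟩
  · -- inertia only shrinks: `I_x ≤ I_{π x}`
    exact (h.subgroup ((inertiaSubgroup ρs x).subgroupOf (inertiaSubgroup ρ (π.base x)))).of_mulEquiv
      (Subgroup.subgroupOfEquivOfLe (InertiaLe.stub_inertia_le ρs ρ π hequiv x))
  · -- Mumford's cover clause
    exact StableAffineCoverBlowup.stub_stableAffineCoverBlowup q ρ hρ hπ ρs hequiv x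

end Summit.ResolutionOfSingularities.ResolutionOfSingularities.Theorems.WildQuotientResolution.PointMove
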